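import Mathlib
import HarnessLib
import Literature.NumberTheory.LFunctions.KMVSignedSecondGap
import Summits.Parity.GeneralizedHardyLittlewood.Theses.PrimeLevelFamEdge
import Summits.Parity.GeneralizedHardyLittlewood.Theorems.BeyondDiagonalBeatsQuarter.MollifierMainTermXSq

/-!
# BC3 skeleton — line `prime-averaged-squeeze` (rev 2) for crux `PrimeLevelFamEdge.BeyondDiagonalBeatsQuarter`
(K_B, VALUE crux, rev-3 closable form `FirstMomentPrinted → C′`; item stmt-Parity-20343; D-0130 STRATEGY A,
seat ls-Bfam-prover-2; binding: ls-lead WORDS #10 S1–S4 / #11, ls-Bfam-plan PROTOCOL.md v1.1 + TENURE RULING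
12:46:53Z (registry slot = line `birth`; this file is a crux WORKFILE, not skeleton-checked by the seat))

REV 2 = THE REFEREE'S CORRECTED OBJECT (ls-ref-1 g7 LINE PRE-READ 12:54:26Z, `stub-overstated`;
LINEREAD-pas-g7.md 2899a5eb7591fd6f, W3.lean 1129bb034ddf0e58). Rev 1's stub A averaged the ABSOLUTE second
defect `secondDefect = ‖Q^h − mainScale·second‖/‖mainScale‖ ≥ 0` — an `L¹` average, no cancellation ACROSS
levels, i.e. diagonal-only at all but `o(#block)` levels individually (pointwise famE-02 strength in averaged
clothing). Rev 2's stub A′ averages the SIGNED gap `signedSecondGap = Q^h − mainScale·second` (Literature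
`KMVSignedSecondGap`, typed from W3.lean): `‖Σ_{q ∈ goodPrimes Δ' N} signedSecondGap X² 1 Δ' q‖ ≤ ε·Σ_q ‖mainScale q Δ'‖`
eventually in `N`. Since the tables `T₂` that K_B quantifies over are LEVEL-FREE and the scales are positive
reals, `Σ_q gap_q = T₂·Σ_q mainScale_q + Σ_q O(‖mainScale_q‖/log q̂)` admits no cancellation in the `T₂`-term:
the squeeze survives verbatim (`KMV2000.T₂_eq_zero_of_signedGap_average`) and A′ ⇒ `T₂(Δ', X², 1) = 0` on
`(1, min Δ (min b 2))`; A ⇒ A′ is proved (`KMV2000.signedGap_average_of_secondDefect_average`), so rev 2 is a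
WEAKENING of the registered input, same composition, same conclusion. A′ is the natural OUTPUT SHAPE of a
level-averaged (dispersion / Kuznetsov-over-levels) evaluation — a signed asymptotic on average — and is blind
to sign-oscillating level-dependent off-diagonal terms that would kill A while leaving K_B intact.

MECHANISM, BARRIER STORY, BED PAIRING, NEGATIVES: as rev 1 (module docstring of `Lines/prime_averaged_squeeze.lean`
049186f0ab5d and card 66a57f02c620), with the bed-6 currency now the SIGNED block sum
`Σ_q (Q^h_q(X²,1; q̂^{Δ'}) − mainScale_q·(4 + 4/Δ'))` normalised by `Σ_q mainScale_q` (A′: → 0; its one-sided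
twin A″: `re ≤ 0` asymptotically, which gives only `T₂ ≤ 0` and then needs the CS floor = `PeterssonBoundPrinted`
for positivity — `KMV2000.T₂_nonpos_of_signedGap_re_average`). No floor and NO Petersson input in rev 2
(`second + T₂ = 4 + 4/Δ' > 0` is explicit once `T₂ = 0`).

STUBS: D `stub_mollifierMainTermXSq` (LANDED p520179/p526832; verbatim as in `birth`) · A′
`stub_primeAveragedSignedSecondGapXSq` (OPEN, the heart, L–XL; (A)-sensitive: biased prime blocks modulo an
exceptional conductor `D ≤ N̂^{η/2}` defeat the signed average exactly as they defeat Iwaniec–Sarnak's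
restricted level average). `_of` hypothesis-free, concludes the route decl BY NAME. Rev 1's A is kept as a
PROVED sufficient condition (`stubA_rev1_gives_rev2`). «The programme SEARCHES and TYPES; no claim about
Landau–Siegel zeros, Theorems 1–2 of arXiv:2211.02515 or a repaired Margin232 until a kernel theorem says so.»
-/

open Polynomial

namespace Summit.Parity.GeneralizedHardyLittlewood.Cruxes.BeyondDiagonalBeatsQuarter.PrimeAveragedSqueeze

open Literature.NumberTheory.LFunctions

/-- stub D (M; LANDED p520179 / p526832 as
`Summit.Parity.GeneralizedHardyLittlewood.Theses.PrimeLevelFamEdge.stub_mollifierMainTermXSq` under this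
name and signature — declared verbatim as in line `birth`): the diagonal Möbius–ψ sum of the first mollified
moment for the profile `X²` has main term `ζ(2)·P′(1)/log M` with error `O(log⁻² M)`.
[cite: KowalskiMichelVanderKam2000, §4.1 (19)–(20), Prop. 4.1 (case k = 0)] -/
theorem stub_mollifierMainTermXSq : KMV2000.MollifierMainTermAsymp (X ^ 2) := by
  sorry

/-- stub A′ (the heart, rev 2; OPEN, L–XL, (A)-sensitive): **the prime-averaged second-moment display with
diagonal-only main term at `(P, Q) = (X², 1)`, SIGNED form, on some window `(1, b)` beyond the diagonal** — for
every `Δ' ∈ (1, b)` and `ε > 0`, eventually in `N`, the signed gaps `Q^h_q(X², 1; q̂^{Δ'}) − mainScale_q·second`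
have block sum over the good primes `q ∈ (N, 2N]` of norm `≤ ε · Σ_q ‖mainScale q Δ'‖`. Same averaging set
`KMV2000.goodPrimes` and scale `KMV2000.mainScale` as p523798; object `KMV2000.signedSecondGap` = the
referee's (ls-ref-1 g7, W3.lean). NOT IN PRINT on any window reaching `Δ' ≥ 1` (famE-02; IS2000 averages ALL
levels, acq-11417). [cite: KowalskiMichelVanderKam2000, §6 p. 19 (second-moment display); p. 28]
[cite: IwaniecConversations2006, §7 p. 97 (level average beyond the diagonal)] -/
theorem stub_primeAveragedSignedSecondGapXSq :
    ∃ b : ℝ, 1 < b ∧ ∀ Δ' : ℝ, 1 < Δ' → Δ' < b → ∀ ε : ℝ, 0 < ε → ∃ N₀ : ℕ, ∀ N : ℕ, N₀ ≤ N →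
      ‖∑ q ∈ KMV2000.goodPrimes Δ' N, KMV2000.signedSecondGap (X ^ 2) 1 Δ' q‖ ≤
        ε * ∑ q ∈ KMV2000.goodPrimes Δ' N, ‖KMV2000.mainScale q Δ'‖ := by
  sorry

/-- **Rev 1's registered input is a sufficient condition for rev 2's** (kernel-checked, no sorry of its own:
`KMV2000.signedGap_average_of_secondDefect_average`): the absolute second-defect average at `(X², 1)` on a
window `(1, b)` gives the signed average there. -/
theorem stubA_rev1_gives_rev2
    (hA : ∃ b : ℝ, 1 < b ∧ ∀ Δ' : ℝ, 1 < Δ' → Δ' < b → ∀ ε : ℝ, 0 < ε → ∃ N₀ : ℕ, ∀ N : ℕ, N₀ ≤ N →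
      ∑ q ∈ KMV2000.goodPrimes Δ' N, KMV2000.secondDefect (X ^ 2) 1 Δ' q ≤
        ε * (KMV2000.goodPrimes Δ' N).card) :
    ∃ b : ℝ, 1 < b ∧ ∀ Δ' : ℝ, 1 < Δ' → Δ' < b → ∀ ε : ℝ, 0 < ε → ∃ N₀ : ℕ, ∀ N : ℕ, N₀ ≤ N →
      ‖∑ q ∈ KMV2000.goodPrimes Δ' N, KMV2000.signedSecondGap (X ^ 2) 1 Δ' q‖ ≤
        ε * ∑ q ∈ KMV2000.goodPrimes Δ' N, ‖KMV2000.mainScale q Δ'‖ := by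
  obtain ⟨b, hb, hav⟩ := hA
  exact ⟨b, hb, fun Δ' h1 h2 ↦
    KMV2000.signedGap_average_of_secondDefect_average (by linarith) (hav Δ' h1 h2)⟩

/-- **Composition (kernel-checked): D and A′ give the rev-3 crux.** The antecedent (Bettin's printed first
moment) and D pin `T₁ Δ' (X²) 1 = 0` on `(1, min Δ 2)` (`KMV2000.firstCorrectionVanishes_of_bettin`); A′ and the
window's `MomentAsymptotics` pin `T₂ Δ' (X²) 1 = 0` on `(1, min Δ (min b 2))`
(`KMV2000.T₂_eq_zero_of_signedGap_average`); then the envelope `Δ'/(2(1+Δ')) > ¼` — packaged as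
`KMV2000.beatsQuarter_of_bettin_of_signedGap_average_X_sq`. -/
theorem BeyondDiagonalBeatsQuarter_of :
    Summit.Parity.GeneralizedHardyLittlewood.Theses.PrimeLevelFamEdge.BeyondDiagonalBeatsQuarter := by
  have hD := stub_mollifierMainTermXSq
  obtain ⟨b, hb, hav⟩ := stub_primeAveragedSignedSecondGapXSq
  unfold Summit.Parity.GeneralizedHardyLittlewood.Theses.PrimeLevelFamEdge.BeyondDiagonalBeatsQuarter
  intro hF
  exact KMV2000.beatsQuarter_of_bettin_of_signedGap_average_X_sq hF hD hb hav

end Summit.Parity.GeneralizedHardyLittlewood.Cruxes.BeyondDiagonalBeatsQuarter.PrimeAveragedSqueeze
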